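import Summits.QuantumFields.GaugeBoot.TwistedSlabHaar
import HarnessLib

/-!
# The baryon vertex of a three-dimensional representation: the `ε`-tensor and the theta form (gauge-boot, L3 negative supplement; SU(3) link reflection at `β < 0`, part 1)

HONEST FRAMING (cell `pub-gaugeboot`, page 1 of every file): the venture produces certified bounds
on lattice expectations at stated coupling, gauge group, dimension and torus size; NOT a mass gap,
NOT a continuum limit, NOT a string tension; NOT Yang–Mills-summit-bearing (barriers
`FixedCouplingUltralocality`, `PerturbativeInvisibility`). This module is pure `3 × 3` matrix algebra
for a NEGATIVE structural result (`FrameLinkRPNegativeBeta.lean`): link (mid-plane) reflection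
positivity of the Wilson measure FAILS at every `β < 0` for a three-dimensional representation of
determinant one (e.g. `SU(3)` in the fundamental), in `d ≥ 3`.

The witness there is the BARYONIC "theta" observable: the three parallel transporters `P_A, P_B, P_C`
from a site `x` to `x + e_l` (around the two `(l, m)`-plaquettes at `x`, and the link itself)
contracted with two `ε`-tensors,

  `Θ(P_A, P_B, P_C) = ∑ ε_{abc} ε_{a'b'c'} (P_A)_{aa'} (P_B)_{bb'} (P_C)_{cc'}`     (`thetaForm`).

Contents (any commutative ring `R`):

* `leviCivita` — the `ε`-tensor on `Fin 3`; `sum_leviCivita_mul_eq_det_colMix` /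
  `thetaForm_eq_sum_det_rowMix`: the inner `ε`-contraction is the determinant of the matrix with
  the three chosen columns (rows);
* `thetaForm_mul_left` / `thetaForm_mul_right` — **gauge covariance**:
  `Θ(M P_A, M P_B, M P_C) = det M · Θ(P_A, P_B, P_C)` and `Θ(P_A M, P_B M, P_C M) = det M · Θ`
  (`Matrix.det_mul`); so `Θ` is invariant under `P ↦ g P g'⁻¹` with `det g = det g' = 1` — the
  baryon vertex is an `SL(3)`-invariant;
* `thetaForm_one` — `Θ(1, 1, 1) = 6` (the observable is not identically zero);
* `thetaForm_mul₃_eq_sum` — the ENTRY EXPANSION of `Θ(M₀M₁M₂, M₃M₄M₅, M₆)` as a finite sum of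
  products of one entry of each of the seven matrices (`ThetaIdx`, `thetaCoef`, `thetaRow`, `thetaCol`)
  — the shape in which the seven link variables are integrated out one at a time
  (`MultilinkSlabIntegral.lean`).

Everything is `[folklore]` linear algebra (no representation theory is used).

References: M. Creutz, Quarks, Gluons and Lattices (1983) Ch. 8 (baryon vertices in strong
coupling); K. Osterwalder, E. Seiler, Ann. Phys. 110 (1978) 440, §2.
-/

namespace Summit.QuantumFields.GaugeBoot

namespace Baryon

open Matrix

variable {R : Type*} [CommRing R]

/-! ## The `ε`-tensor on `Fin 3` -/

/-- The Levi-Civita symbol on `Fin 3` (values in `ℤ`). [folklore] -/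
def leviCivita : Fin 3 → Fin 3 → Fin 3 → ℤ :=
  ![![![0, 0, 0], ![0, 0, 1], ![0, -1, 0]],
    ![![0, 0, -1], ![0, 0, 0], ![1, 0, 0]],
    ![![0, 1, 0], ![-1, 0, 0], ![0, 0, 0]]]

/-- The matrix whose columns are column `a` of `P`, column `b` of `Q`, column `c` of `S`. [folklore] -/
def colMix (P Q S : Matrix (Fin 3) (Fin 3) R) (a b c : Fin 3) : Matrix (Fin 3) (Fin 3) R :=
  Matrix.of fun i j => ![P i a, Q i b, S i c] j

/-- The matrix whose rows are row `a` of `P`, row `b` of `Q`, row `c` of `S`. [folklore] -/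
def rowMix (P Q S : Matrix (Fin 3) (Fin 3) R) (a b c : Fin 3) : Matrix (Fin 3) (Fin 3) R :=
  Matrix.of fun i j => ![P a j, Q b j, S c j] i

/-- **The inner `ε`-contraction over first indices is a determinant of mixed columns**:
`∑_{abc} ε_{abc} P_{aa'} Q_{bb'} S_{cc'} = det (colMix P Q S a' b' c')`. [folklore] -/
theorem sum_leviCivita_mul_eq_det_colMix (P Q S : Matrix (Fin 3) (Fin 3) R) (a' b' c' : Fin 3) :
    ∑ a, ∑ b, ∑ c, (leviCivita a b c : R) * (P a a' * Q b b' * S c c') =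
      (colMix P Q S a' b' c').det := by
  rw [Matrix.det_fin_three]
  simp [Fin.sum_univ_three, leviCivita, colMix]
  ring

/-- **The inner `ε`-contraction over second indices is a determinant of mixed rows**:
`∑_{a'b'c'} ε_{a'b'c'} P_{aa'} Q_{bb'} S_{cc'} = det (rowMix P Q S a b c)`. [folklore] -/
theorem sum_leviCivita_mul_eq_det_rowMix (P Q S : Matrix (Fin 3) (Fin 3) R) (a b c : Fin 3) :
    ∑ a', ∑ b', ∑ c', (leviCivita a' b' c' : R) * (P a a' * Q b b' * S c c') =
      (rowMix P Q S a b c).det := by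
  rw [Matrix.det_fin_three]
  simp [Fin.sum_univ_three, leviCivita, rowMix]
  ring

/-- Mixed columns of left-multiplied matrices: `colMix (MP) (MQ) (MS) = M · colMix P Q S`. [folklore] -/
theorem colMix_mul_left (M P Q S : Matrix (Fin 3) (Fin 3) R) (a b c : Fin 3) :
    colMix (M * P) (M * Q) (M * S) a b c = M * colMix P Q S a b c := by
  ext i j
  fin_cases j <;> simp [colMix, Matrix.mul_apply]

/-- Mixed rows of right-multiplied matrices: `rowMix (PM) (QM) (SM) = rowMix P Q S · M`. [folklore] -/
theorem rowMix_mul_right (M P Q S : Matrix (Fin 3) (Fin 3) R) (a b c : Fin 3) :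
    rowMix (P * M) (Q * M) (S * M) a b c = rowMix P Q S a b c * M := by
  ext i j
  fin_cases i <;> simp [rowMix, Matrix.mul_apply]

/-! ## The theta form -/

/-- **The theta form** (baryon–antibaryon contraction of three transporters):
`Θ(P, Q, S) = ∑_{abc a'b'c'} ε_{abc} ε_{a'b'c'} P_{aa'} Q_{bb'} S_{cc'}`. [folklore] -/
def thetaForm (P Q S : Matrix (Fin 3) (Fin 3) R) : R :=
  ∑ a, ∑ b, ∑ c, ∑ a', ∑ b', ∑ c',
    (leviCivita a b c : R) * (leviCivita a' b' c' : R) * (P a a' * Q b b' * S c c')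

/-- Commuting a triple sum past a triple sum. [folklore] -/
theorem sum₃_sum₃_comm {M : Type*} [AddCommMonoid M] (f : Fin 3 → Fin 3 → Fin 3 → Fin 3 → Fin 3 → Fin 3 → M) :
    ∑ a, ∑ b, ∑ c, ∑ a', ∑ b', ∑ c', f a b c a' b' c' =
      ∑ a', ∑ b', ∑ c', ∑ a, ∑ b, ∑ c, f a b c a' b' c' := by
  calc ∑ a, ∑ b, ∑ c, ∑ a', ∑ b', ∑ c', f a b c a' b' c'
      = ∑ x : Fin 3 × Fin 3 × Fin 3, ∑ y : Fin 3 × Fin 3 × Fin 3,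
          f x.1 x.2.1 x.2.2 y.1 y.2.1 y.2.2 := by
        simp only [Fintype.sum_prod_type]
    _ = ∑ y : Fin 3 × Fin 3 × Fin 3, ∑ x : Fin 3 × Fin 3 × Fin 3,
          f x.1 x.2.1 x.2.2 y.1 y.2.1 y.2.2 := Finset.sum_comm
    _ = ∑ a', ∑ b', ∑ c', ∑ a, ∑ b, ∑ c, f a b c a' b' c' := by
        simp only [Fintype.sum_prod_type]

/-- `Θ` as a sum of determinants of mixed columns:
`Θ(P, Q, S) = ∑_{a'b'c'} ε_{a'b'c'} det (colMix P Q S a' b' c')`. [folklore] -/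
theorem thetaForm_eq_sum_det_colMix (P Q S : Matrix (Fin 3) (Fin 3) R) :
    thetaForm P Q S = ∑ a', ∑ b', ∑ c', (leviCivita a' b' c' : R) * (colMix P Q S a' b' c').det := by
  unfold thetaForm
  rw [sum₃_sum₃_comm]
  refine Finset.sum_congr rfl fun a' _ => Finset.sum_congr rfl fun b' _ =>
    Finset.sum_congr rfl fun c' _ => ?_
  rw [← sum_leviCivita_mul_eq_det_colMix, Finset.mul_sum]
  refine Finset.sum_congr rfl fun a _ => ?_
  rw [Finset.mul_sum]
  refine Finset.sum_congr rfl fun b _ => ?_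
  rw [Finset.mul_sum]
  exact Finset.sum_congr rfl fun c _ => by ring

/-- `Θ` as a sum of determinants of mixed rows:
`Θ(P, Q, S) = ∑_{abc} ε_{abc} det (rowMix P Q S a b c)`. [folklore] -/
theorem thetaForm_eq_sum_det_rowMix (P Q S : Matrix (Fin 3) (Fin 3) R) :
    thetaForm P Q S = ∑ a, ∑ b, ∑ c, (leviCivita a b c : R) * (rowMix P Q S a b c).det := by
  unfold thetaForm
  refine Finset.sum_congr rfl fun a _ => Finset.sum_congr rfl fun b _ =>
    Finset.sum_congr rfl fun c _ => ?_
  rw [← sum_leviCivita_mul_eq_det_rowMix, Finset.mul_sum]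
  refine Finset.sum_congr rfl fun a' _ => ?_
  rw [Finset.mul_sum]
  refine Finset.sum_congr rfl fun b' _ => ?_
  rw [Finset.mul_sum]
  exact Finset.sum_congr rfl fun c' _ => by ring

/-- **Left gauge covariance of the theta form**: `Θ(MP, MQ, MS) = det M · Θ(P, Q, S)`. [folklore] -/
theorem thetaForm_mul_left (M P Q S : Matrix (Fin 3) (Fin 3) R) :
    thetaForm (M * P) (M * Q) (M * S) = M.det * thetaForm P Q S := by
  rw [thetaForm_eq_sum_det_colMix, thetaForm_eq_sum_det_colMix, Finset.mul_sum]
  refine Finset.sum_congr rfl fun a' _ => ?_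
  rw [Finset.mul_sum]
  refine Finset.sum_congr rfl fun b' _ => ?_
  rw [Finset.mul_sum]
  refine Finset.sum_congr rfl fun c' _ => ?_
  rw [colMix_mul_left, Matrix.det_mul]
  ring

/-- **Right gauge covariance of the theta form**: `Θ(PM, QM, SM) = det M · Θ(P, Q, S)`. [folklore] -/
theorem thetaForm_mul_right (M P Q S : Matrix (Fin 3) (Fin 3) R) :
    thetaForm (P * M) (Q * M) (S * M) = M.det * thetaForm P Q S := by
  rw [thetaForm_eq_sum_det_rowMix, thetaForm_eq_sum_det_rowMix, Finset.mul_sum]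
  refine Finset.sum_congr rfl fun a _ => ?_
  rw [Finset.mul_sum]
  refine Finset.sum_congr rfl fun b _ => ?_
  rw [Finset.mul_sum]
  refine Finset.sum_congr rfl fun c _ => ?_
  rw [rowMix_mul_right, Matrix.det_mul]
  ring

/-- **Gauge invariance of the theta form**: for `det g = det g' = 1`,
`Θ(g P g', g Q g', g S g') = Θ(P, Q, S)`. [folklore] -/
theorem thetaForm_conj (g g' P Q S : Matrix (Fin 3) (Fin 3) R) (hg : g.det = 1) (hg' : g'.det = 1) :
    thetaForm (g * P * g') (g * Q * g') (g * S * g') = thetaForm P Q S := by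
  rw [thetaForm_mul_right, thetaForm_mul_left, hg, hg', one_mul, one_mul]

/-- **`Θ(1, 1, 1) = 6`** (`= ∑ ε_{abc}²`): the theta form does not vanish identically. [folklore] -/
theorem thetaForm_one : thetaForm (1 : Matrix (Fin 3) (Fin 3) R) 1 1 = 6 := by
  simp [thetaForm, Fin.sum_univ_three, leviCivita, Matrix.one_apply]
  norm_num

/-! ## The entry expansion of `Θ(M₀M₁M₂, M₃M₄M₅, M₆)` -/

/-- The index set of the entry expansion: the six `ε`-indices `a b c a' b' c'` and the four inner
indices `q p s r` of the two triple products (`M₀M₁M₂` summed over `r, s`; `M₃M₄M₅` over `p, q`). [folklore] -/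
abbrev ThetaIdx : Type :=
  Fin 3 × Fin 3 × Fin 3 × Fin 3 × Fin 3 × Fin 3 × Fin 3 × Fin 3 × Fin 3 × Fin 3

namespace ThetaIdx

/-- `a`. [folklore] -/
abbrev a (ι : ThetaIdx) : Fin 3 := ι.1
/-- `b`. [folklore] -/
abbrev b (ι : ThetaIdx) : Fin 3 := ι.2.1
/-- `c`. [folklore] -/
abbrev c (ι : ThetaIdx) : Fin 3 := ι.2.2.1
/-- `a'`. [folklore] -/
abbrev a' (ι : ThetaIdx) : Fin 3 := ι.2.2.2.1
/-- `b'`. [folklore] -/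
abbrev b' (ι : ThetaIdx) : Fin 3 := ι.2.2.2.2.1
/-- `c'`. [folklore] -/
abbrev c' (ι : ThetaIdx) : Fin 3 := ι.2.2.2.2.2.1
/-- `q` (between `M₄` and `M₅`). [folklore] -/
abbrev q (ι : ThetaIdx) : Fin 3 := ι.2.2.2.2.2.2.1
/-- `p` (between `M₃` and `M₄`). [folklore] -/
abbrev p (ι : ThetaIdx) : Fin 3 := ι.2.2.2.2.2.2.2.1
/-- `s` (between `M₁` and `M₂`). [folklore] -/
abbrev s (ι : ThetaIdx) : Fin 3 := ι.2.2.2.2.2.2.2.2.1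
/-- `r` (between `M₀` and `M₁`). [folklore] -/
abbrev r (ι : ThetaIdx) : Fin 3 := ι.2.2.2.2.2.2.2.2.2

end ThetaIdx

/-- The coefficient `ε_{abc} ε_{a'b'c'}` of the entry expansion. [folklore] -/
def thetaCoef (ι : ThetaIdx) : ℤ := leviCivita ι.a ι.b ι.c * leviCivita ι.a' ι.b' ι.c'

/-- The row index of the entry of the `r`-th matrix (`r : Fin 7`) in the entry expansion. [folklore] -/
def thetaRow (ι : ThetaIdx) : Fin 7 → Fin 3 := ![ι.a, ι.r, ι.s, ι.b, ι.p, ι.q, ι.c]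

/-- The column index of the entry of the `r`-th matrix in the entry expansion. [folklore] -/
def thetaCol (ι : ThetaIdx) : Fin 7 → Fin 3 := ![ι.r, ι.s, ι.a', ι.p, ι.q, ι.b', ι.c']

/-- **The entry expansion of the theta form of two triple products and a matrix**:
`Θ(M₀M₁M₂, M₃M₄M₅, M₆) = ∑_ι ε_{abc} ε_{a'b'c'} · (M₀)_{ar} (M₁)_{rs} (M₂)_{sa'} (M₃)_{bp} (M₄)_{pq} (M₅)_{qb'} (M₆)_{cc'}`,
written as `∑_ι thetaCoef ι · ∏_{r : Fin 7} (M r) (thetaRow ι r) (thetaCol ι r)`. [folklore] -/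
theorem thetaForm_mul₃_eq_sum (M : Fin 7 → Matrix (Fin 3) (Fin 3) R) :
    thetaForm (M 0 * M 1 * M 2) (M 3 * M 4 * M 5) (M 6) =
      ∑ ι : ThetaIdx, (thetaCoef ι : R) * ∏ r : Fin 7, M r (thetaRow ι r) (thetaCol ι r) := by
  simp only [thetaForm, Fintype.sum_prod_type, thetaCoef, thetaRow, thetaCol, ThetaIdx.a, ThetaIdx.b,
    ThetaIdx.c, ThetaIdx.a', ThetaIdx.b', ThetaIdx.c', ThetaIdx.p, ThetaIdx.q, ThetaIdx.r, ThetaIdx.s,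
    Fin.prod_univ_seven, Matrix.cons_val_zero,
    Matrix.mul_apply, Finset.sum_mul, Finset.mul_sum, Int.cast_mul]
  refine Finset.sum_congr rfl fun a _ => Finset.sum_congr rfl fun b _ =>
    Finset.sum_congr rfl fun c _ => Finset.sum_congr rfl fun a' _ => Finset.sum_congr rfl fun b' _ =>
    Finset.sum_congr rfl fun c' _ => Finset.sum_congr rfl fun q _ => Finset.sum_congr rfl fun p _ =>
    Finset.sum_congr rfl fun s _ => Finset.sum_congr rfl fun r _ => ?_
  simp only [Matrix.cons_val]
  ring

end Baryon

end Summit.QuantumFields.GaugeBoot
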